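import Literature.AnabelianGeometry.EtaleTheta.FrobenioidThetaDivisorSupportQAdjacencyCount

/-!
# [EtTh] §5, Proposition 5.3 (v) over PERFECT `Φ(A_⊚)`: the "4 versus 5 or 6" adjacency criterion FROM the intersection theory of the chain (repair `Q`, part 3)

Mochizuki, *The étale theta function …*, Publ. RIMS **45** (2009)
[cite: MochizukiEtTh2009, Prop 5.3 proof p.326–327 (PDF pp.100–101); §1 p.240 (PDF p.14)].
Seat abc-iut-L6-d1 (gen 4); proof-only port of this lineage's `FrobenioidThetaDivisorSupportAdjacency.lean` (p433547,
over the `ℤ`-reading, vacuous at perfect `Φ(A_⊚)` by p436191) to the repair `Q`: for `a = m·gen 𝔭` of integral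
multiplicity and its correspondent `b = m·gen 𝔮` under the PINNED natural isomorphism of (ii) (`ncspIso_gen_pow`), the
cuspidally minimal elements linearly equivalent to `a + b` all have `#{components of non-zero degree}` cusps
(`ncard_supp_of_isCuspidallyMinimal_pair`), which is `4` iff `|p − q| = 1` and `5` or `6` otherwise
(`adjacencyCriterionQ_of_principalIffIntegralDegreeZero`).
HONEST FRAMING: implications between predicates on OUR typed data under the explicit binder; no side taken on anything
downstream; typed ≠ proved for the genuine curve. -/

namespace Literature.AnabelianGeometry.EtaleTheta

open CategoryTheory
open Literature.AlgebraicGeometry.Frobenioids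

universe w v v' u u'

namespace FrobenioidThetaDivisors

open scoped Classical

variable {C : Type u} [Category.{v} C] {D : Type u'} [Category.{v'} D] {𝔉 : ThetaFrobenioid.{w} C D}
variable {𝔓 : DivisorPrimeData 𝔉}

namespace DivisorSupportDataQ

open scoped Classical


/-- Under `PrincipalIffIntegralDegreeZero`, for `V = m·(gen P + gen Q)` (`P ≠ Q`, `m ≥ 1`): the cuspidally minimal
elements linearly equivalent to `V` all have support of cardinality `#{components of non-zero V-degree}`, and
there is one.  [cite: MochizukiEtTh2009, Prop 5.3 proof p.326–327 (PDF pp.100–101)] -/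
theorem ncard_supp_of_isCuspidallyMinimal_pair (𝔖 : DivisorSupportDataQ 𝔓) (hI : 𝔖.PrincipalIffIntegralDegreeZero)
    (P Q : {p : Primes 𝔉.PhiAcirc // ¬ 𝔓.IsCuspidal p}) (hPQ : P ≠ Q) (m : ℕ) (hm : 0 < m) :
    (∀ c, 𝔖.IsCuspidallyMinimal c →
      𝔖.LinEquiv c (Algebra.GrothendieckGroup.of (𝔖.gen P.1) ^ m * Algebra.GrothendieckGroup.of (𝔖.gen Q.1) ^ m) →
      (𝔖.supp c).ncard = {𝔪 | 𝔖.degOn 𝔪 (Algebra.GrothendieckGroup.of (𝔖.gen P.1) ^ m *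
        Algebra.GrothendieckGroup.of (𝔖.gen Q.1) ^ m) ≠ 0}.ncard) ∧
    (∃ c, 𝔖.IsCuspidallyMinimal c ∧
      𝔖.LinEquiv c (Algebra.GrothendieckGroup.of (𝔖.gen P.1) ^ m * Algebra.GrothendieckGroup.of (𝔖.gen Q.1) ^ m)) := by
  obtain ⟨c₀, hc₀cusp, hc₀fin, hc₀lin, hc₀card⟩ := 𝔖.exists_cuspidal_linEquiv_pair hI P Q hPQ m hm
  set V := Algebra.GrothendieckGroup.of (𝔖.gen P.1) ^ m * Algebra.GrothendieckGroup.of (𝔖.gen Q.1) ^ m with hVdef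
  have hVfin : (𝔖.supp V).Finite :=
    ((((𝔖.supp_gen_finite P.1).subset (𝔖.supp_pow_subset _ m))).union
      ((𝔖.supp_gen_finite Q.1).subset (𝔖.supp_pow_subset _ m))).subset (𝔖.supp_mul_subset _ _)
  have hP : ∀ x : Algebra.GrothendieckGroup 𝔉.PhiAcirc, 𝔖.IsPrincipal x → ∀ 𝔪, 𝔖.degOn 𝔪 x = 0 :=
    fun x hx => ((hI x).mp hx).2
  have hc₀min : 𝔖.IsCuspidallyMinimal c₀ := by
    refine ⟨hc₀cusp, hc₀fin, fun y hy hyfin hylin => ?_⟩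
    change (𝔖.supp c₀).ncard ≤ (𝔖.supp y).ncard
    rw [hc₀card]
    have hyV : 𝔖.LinEquiv y V := by
      change y * V⁻¹ ∈ 𝔖.principal
      have h := 𝔖.principal.mul_mem hylin hc₀lin
      convert h using 1; group
    exact 𝔖.ncard_le_of_cuspidal_linEquiv hP hVfin hy hyfin hyV
  refine ⟨fun c hc hlin => le_antisymm ?_ ?_, c₀, hc₀min, hc₀lin⟩
  · -- `≤`: minimality of `c` against the competitor `c₀ ∼ c`
    have hlin' : LinEquivOf 𝔖.principal c₀ c := by
      change c₀ * c⁻¹ ∈ 𝔖.principal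
      have h := 𝔖.principal.mul_mem hc₀lin (𝔖.principal.inv_mem hlin)
      convert h using 1; group
    have h := hc.2.2 c₀ hc₀cusp hc₀fin hlin'
    change (𝔖.supp c).ncard ≤ (𝔖.supp c₀).ncard at h
    rwa [hc₀card] at h
  · -- `≥`: a cusp over every component of non-zero degree
    exact 𝔖.ncard_le_of_cuspidal_linEquiv hP hVfin hc.1 hc.2.1 hlin

/-- **[EtTh] Prop. 5.3 (v), the "4 versus 5 or 6" criterion over PERFECT `Φ(A_⊚)`, from the intersection theory of
the chain**: `PrincipalIffIntegralDegreeZero 𝔖 → AdjacencyCriterionQ 𝔖`.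
[cite: MochizukiEtTh2009, Prop 5.3 proof p.326–327 (PDF pp.100–101); §1 p.240 (PDF p.14)] -/
theorem adjacencyCriterionQ_of_principalIffIntegralDegreeZero (𝔖 : DivisorSupportDataQ 𝔓) (hI : 𝔖.PrincipalIffIntegralDegreeZero) :
    AdjacencyCriterionQ 𝔖 := by
  intro 𝔭 𝔮 h𝔭 h𝔮 hne m hm a hagen
  -- `a = m·gen 𝔭`, and its correspondent `b = m·gen 𝔮` (pin of (ii))
  have hbgen : ((𝔓.ncspIso 𝔭 𝔮 h𝔭 h𝔮 a : 𝔮.submonoid) : 𝔉.PhiAcirc) = 𝔖.gen 𝔮 ^ m :=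
    𝔖.ncspIso_gen_pow 𝔭 𝔮 h𝔭 h𝔮 m a hagen
  have hPQ : (⟨𝔭, h𝔭⟩ : {p : Primes 𝔉.PhiAcirc // ¬ 𝔓.IsCuspidal p}) ≠ ⟨𝔮, h𝔮⟩ :=
    fun h => hne (congrArg Subtype.val h)
  have hpq : 𝔓.ncspEquivZ ⟨𝔭, h𝔭⟩ ≠ 𝔓.ncspEquivZ ⟨𝔮, h𝔮⟩ := fun h => hPQ (𝔓.ncspEquivZ.injective h)
  obtain ⟨hall, c₀, hc₀min, hc₀lin⟩ := 𝔖.ncard_supp_of_isCuspidallyMinimal_pair hI ⟨𝔭, h𝔭⟩ ⟨𝔮, h𝔮⟩ hPQ m hm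
  have hcount := 𝔖.ncard_setOf_degOn_pair_ne_zero ⟨𝔭, h𝔭⟩ ⟨𝔮, h𝔮⟩ m hPQ hm
  have hV : Algebra.GrothendieckGroup.of (a : 𝔉.PhiAcirc) *
      Algebra.GrothendieckGroup.of ((𝔓.ncspIso 𝔭 𝔮 h𝔭 h𝔮 a : 𝔮.submonoid) : 𝔉.PhiAcirc) =
      Algebra.GrothendieckGroup.of (𝔖.gen 𝔭) ^ m * Algebra.GrothendieckGroup.of (𝔖.gen 𝔮) ^ m := by
    rw [hagen, hbgen, map_pow, map_pow]
  show (_ ↔ _) ∧ (_ ↔ _)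
  rw [hV]
  constructor
  · -- adjacent ↔ every cuspidally minimal `c ∼ a + b` has `#supp c = 4`
    unfold Adjacent
    rw [← chainNbhd_card_eq_four_iff hpq, ← hcount]
    constructor
    · intro h4 c hc hlin; rw [hall c hc hlin]; exact h4
    · intro h; rw [← hall c₀ hc₀min hc₀lin]; exact h c₀ hc₀min hc₀lin
  · -- not adjacent ↔ every cuspidally minimal `c ∼ a + b` has `#supp c = 5` or `6`
    unfold Adjacent
    rw [← ne_eq, ← chainNbhd_card_eq_five_or_six_iff hpq, ← hcount]
    constructor
    · intro h56 c hc hlin; rw [hall c hc hlin]; exact h56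
    · intro h; rw [← hall c₀ hc₀min hc₀lin]; exact h c₀ hc₀min hc₀lin

end DivisorSupportDataQ

end FrobenioidThetaDivisors

end Literature.AnabelianGeometry.EtaleTheta
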